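import Summits.QuantumFields.YangMills.Theorems.FluctuationComparisonRegPrIntLOrganTangentLawCumulantResponse
import Summits.QuantumFields.YangMills.Theorems.FluctuationComparisonRegPrIntLOrganTangentLawEdgeIntegration
import HarnessLib

/-!
# Crux `FluctuationComparisonRegPrIntL` (stmt-QuantumFields-20520, rung R3), PATH-B organ, H-currency cone — (L26b) THE D4 LAW-SIDE INTEGRATION BRICKS «(L23)∕(L24)∕(L26a) + cumulant
# kernels ⟹ (JV3-h′) ∕ (JV4-h′)» (DISCHARGE SPEC v1.0 §6 step 4, D4 law side; LEAD w3 g26 №22 (1): first refusal w5, exercised)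

Cell `ym3-torus` (YM ladder rung R3 = continuum `SU(2)` Yang–Mills on the three-torus — a RUNG: NOT d = 4, NOT infinite volume, NOT a mass gap, NOT Clay).
Width seat `ym-ust-20520-w5` (gen 24), `--supports stmt-QuantumFields-20520 --as helper`, count-neutral, no registry ∕ binder ∕ `Lines/` edit, DEFINITION-FREE,
default heartbeats.  Over ✓(L23a) p815758, ✓(L24) p816100, ✓(L23b) DOCK p816159, ✓(L25) `…LawEdgeIntegration`, ✓(L26a) `…LawCumulantResponse` and the reviewed letters of ✓p812742.

WHAT.  The Jensen row `SpreadFibreLawHJ` (✓p814004) has two LAW-SIDE second-moment brackets with OWN-law centrings (`c = ∫ …` binders):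
* (JV3-h′) «`Δ^{law}_{B′} Cov(Δ, S)`»: `|∫ (Δ − c₁)(S − e₁)·ŵ_t(W₂) − ∫ (Δ − c₂)(S − e₂)·ŵ_t(U₂)| ≤ ℓ`, `Δ = F_{V₁} − F_{U₁}`, `S = F_{V₁} + F_{U₁}`, law edge `U₂ → W₂` at `B′`.
  ★★★`covEdgeClause_of_cum3Kernel`: ANY law path `X` with `X 0 = U₂`, `X 1 = W₂`; (L23a) path-regularity data for `s ↦ wNum … t (X s) ·` with the frozen factors `Δ, S, Δ·S`
  (derivative family `wN′`, dominators, integrability, masses `≠ 0`), the CUT clause, and the SCORE-form third-cumulant kernel on `[0,1]` (`κ₃`-blocks of `Δ, S` with the score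
  `r_s = wN′ s ∕ wNum(X s)` under `ŵ_s`, ✓(L26a) `normCov_deriv_eq_cum3_of_null`'s right-hand side, `≤ ℓ`) ⟹ the (JV3-h′) body VERBATIM (`∀ c₁ e₁ c₂ e₂, c₁ = ∫ … → … →
  Integrable ∧ Integrable ∧ |…| ≤ ℓ`).  Engine: ✓(L23a) `abs_normCov_one_sub_zero_le`, own centrings ↔ uncentred by ✓`integral_centred_mul_eq` (`∫ ŵ_t = 1` from the mass).
* (JV4-h′) «`ΔΔ^{law} Var[F_{V00}]`»: `|∫ (F − c₁₁)²ŵ(V11) − ∫ (F − c₁₀)²ŵ(V10) − ∫ (F − c₀₁)²ŵ(V01) + ∫ (F − c₀₀)²ŵ(V00)| ≤ ℓ`.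
  ★★★`varSquareClause_of_mixedKernel`: ANY two-parameter law path with corners `V00 V10 V01 V11`; ✓(L26a) `abs_normVar_secondDiff_le`'s data for
  `w s s′ z := wNum … t (X s s′) z` and its kernel `|ψ₁₂ − 2(φ₁φ₂ + φφ₁₂)| ≤ ℓ` (the seven path functionals as binders with defining equations) ⟹ the (JV4-h′) body VERBATIM.

HONEST FRAMING: bookkeeping [folklore]; path regularity and the cumulant kernels are HYPOTHESES (D0 ∕ «FIBRE-LAW CLUSTER BOUNDS»), no letter is priced; nothing of Bałaban's
analysis is asserted or proved; `SpreadFibreLawH` ∕ `SpreadFibreLawHJ` are HYPOTHESIS rows; LIN″ ∕ JVAR″ ∕ JEN″ ∕ O1ᵘ-H v2.2 ∕ S1aᴴ ∕ S3ᴴ ∕ S2α′ ∕ S2β, the five registered stubs of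
`Lines/semiclassical_s2beta.lean`, crux 20520 `FluctuationComparisonRegPrIntL` and `YM3TorusSU2` are NOT proved; registry untouched; rung R3 = SU(2) YM₃ on T³ at fixed
lattice data — NOT d = 4, NOT infinite volume, NOT a mass gap, NOT Clay; the Yang–Mills mass gap is NOT proved.  [folklore].
-/

set_option autoImplicit false

noncomputable section

namespace Summit.QuantumFields.YangMills.Theorems.OrganTangentLawCumulantIntegration

open MeasureTheory Filter Topology Set Function
open scoped ENNReal
open Literature.MathematicalPhysics.QuantumFieldTheory.Balaban1983to89 T3ContinuumYM3Torus T3NestedUnitLaws T3UnitLawDensityEML T4Continuum BalabanUVClass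
open T4CubeChartExp (expPt)
open Summit.QuantumFields.YangMills.Theorems.FluctuationComparisonRegPrIntLRunpairOrganFibreLaw (wNum wgt)
open Summit.QuantumFields.YangMills.Theorems.OrganTangentLawEdgeResponse
open Summit.QuantumFields.YangMills.Theorems.OrganTangentLawSquareResponse
open Summit.QuantumFields.YangMills.Theorems.OrganTangentLawEdgeResponseDock
open Summit.QuantumFields.YangMills.Theorems.OrganTangentLawCumulantResponse
open Summit.QuantumFields.YangMills.Theorems.OrganTangentLawEdgeIntegration

/-! ## §1 The interpolated fibre law is normalised wherever its mass is non-zero -/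

section Norm

/-- `∫ wgt … t V dτ = 1` from `∫ wNum … t V dτ ≠ 0` (DOCK `integral_mul_wgt_eq_div` with `f = 1`, `div_self`).  (✓`OrganTangentFibreWeightNormalisation.wgt_normalised` supplies the
mass at window points; here only the algebra.) [folklore] -/
theorem integral_wgt_eq_one (F : T3Family) (γ b₀ p₀ : ℝ) (j Ts : ℕ)
    (ρ ρ' : (i : ℕ) → GaugeField (F.P i) 0 ↥(Matrix.specialUnitaryGroup (Fin 2) ℂ) → ℝ) {Zc : Type} [MeasurableSpace Zc] (τ : Measure Zc)
    (Φ : GaugeField (F.P j) 0 ↥(Matrix.specialUnitaryGroup (Fin 2) ℂ) × Zc → GaugeField (F.P Ts) 0 ↥(Matrix.specialUnitaryGroup (Fin 2) ℂ))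
    (J : GaugeField (F.P j) 0 ↥(Matrix.specialUnitaryGroup (Fin 2) ℂ) × Zc → NNReal) (t : ℝ)
    (V : GaugeField (F.P j) 0 ↥(Matrix.specialUnitaryGroup (Fin 2) ℂ)) (hZ : ∫ z, wNum F γ b₀ p₀ j Ts ρ ρ' Φ J t V z ∂τ ≠ 0) :
    ∫ z, (wgt F γ b₀ p₀ j Ts ρ ρ' τ Φ J t) V z ∂τ = 1 := by
  have h := integral_mul_wgt_eq_div F γ b₀ p₀ j Ts ρ ρ' τ Φ J t V (fun _ => (1:ℝ))
  simp only [one_mul] at h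
  rw [h, div_self hZ]

end Norm


/-! ## §2 (JV3-h′): the law edge of an own-centred covariance -/

section CovEdge

/-- ★★★ **THE D4 LAW-SIDE BRICK FOR (JV3-h′)** (see the module docstring): path regularity of `s ↦ wNum … t (X s) ·` with the frozen factors `Δ = F_{V₁} − F_{U₁}`,
`S = F_{V₁} + F_{U₁}`, `Δ·S` along ANY law path `X` from `U₂` to `W₂`, the cut clause, and the SCORE-form third-cumulant kernel `≤ ℓ` on `[0,1]` ⟹ the (JV3-h′) body of
✓p814004 VERBATIM (own centrings as `c = ∫ …` binders). [folklore] -/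
theorem covEdgeClause_of_cum3Kernel (F : T3Family) (γ b₀ p₀ : ℝ) (j Ts : ℕ)
    (ρ ρ' : (i : ℕ) → GaugeField (F.P i) 0 ↥(Matrix.specialUnitaryGroup (Fin 2) ℂ) → ℝ) {Zc : Type} [MeasurableSpace Zc] (τ : Measure Zc)
    (Φ : GaugeField (F.P j) 0 ↥(Matrix.specialUnitaryGroup (Fin 2) ℂ) × Zc → GaugeField (F.P Ts) 0 ↥(Matrix.specialUnitaryGroup (Fin 2) ℂ))
    (J : GaugeField (F.P j) 0 ↥(Matrix.specialUnitaryGroup (Fin 2) ℂ) × Zc → NNReal) (t : ℝ)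
    (U₁ V₁ U₂ W₂ : GaugeField (F.P j) 0 ↥(Matrix.specialUnitaryGroup (Fin 2) ℂ))
    (X : ℝ → GaugeField (F.P j) 0 ↥(Matrix.specialUnitaryGroup (Fin 2) ℂ)) (hX0 : X 0 = U₂) (hX1 : X 1 = W₂)
    (wN' : ℝ → Zc → ℝ) {U : Set ℝ} (hU : IsOpen U) (hUI : Icc (0:ℝ) 1 ⊆ U)
    (hmD : AEStronglyMeasurable (fun z => ((Real.log (ρ Ts (Φ (V₁, z))) - Real.log (ρ' Ts (Φ (V₁, z)))) - (Real.log (ρ Ts (Φ (U₁, z))) - Real.log (ρ' Ts (Φ (U₁, z)))))) τ) (hmS : AEStronglyMeasurable (fun z => ((Real.log (ρ Ts (Φ (V₁, z))) - Real.log (ρ' Ts (Φ (V₁, z)))) + (Real.log (ρ Ts (Φ (U₁, z))) - Real.log (ρ' Ts (Φ (U₁, z)))))) τ)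
    (hm : ∀ s, AEStronglyMeasurable (fun z => wNum F γ b₀ p₀ j Ts ρ ρ' Φ J t (X s) z) τ) (hm' : ∀ s, AEStronglyMeasurable (wN' s) τ)
    (hi : ∀ s ∈ Icc (0:ℝ) 1, Integrable (fun z => wNum F γ b₀ p₀ j Ts ρ ρ' Φ J t (X s) z) τ)
    (hiD : ∀ s ∈ Icc (0:ℝ) 1, Integrable (fun z => ((Real.log (ρ Ts (Φ (V₁, z))) - Real.log (ρ' Ts (Φ (V₁, z)))) - (Real.log (ρ Ts (Φ (U₁, z))) - Real.log (ρ' Ts (Φ (U₁, z))))) * wNum F γ b₀ p₀ j Ts ρ ρ' Φ J t (X s) z) τ)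
    (hiS : ∀ s ∈ Icc (0:ℝ) 1, Integrable (fun z => ((Real.log (ρ Ts (Φ (V₁, z))) - Real.log (ρ' Ts (Φ (V₁, z)))) + (Real.log (ρ Ts (Φ (U₁, z))) - Real.log (ρ' Ts (Φ (U₁, z))))) * wNum F γ b₀ p₀ j Ts ρ ρ' Φ J t (X s) z) τ)
    (hiDS : ∀ s ∈ Icc (0:ℝ) 1, Integrable (fun z => (((Real.log (ρ Ts (Φ (V₁, z))) - Real.log (ρ' Ts (Φ (V₁, z)))) - (Real.log (ρ Ts (Φ (U₁, z))) - Real.log (ρ' Ts (Φ (U₁, z))))) * ((Real.log (ρ Ts (Φ (V₁, z))) - Real.log (ρ' Ts (Φ (V₁, z)))) + (Real.log (ρ Ts (Φ (U₁, z))) - Real.log (ρ' Ts (Φ (U₁, z)))))) * wNum F γ b₀ p₀ j Ts ρ ρ' Φ J t (X s) z) τ)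
    {bound : Zc → ℝ} (hb : ∀ᵐ z ∂τ, ∀ s ∈ U, |wN' s z| ≤ bound z) (hbi : Integrable bound τ)
    {bD : Zc → ℝ} (hbD : ∀ᵐ z ∂τ, ∀ s ∈ U, |((Real.log (ρ Ts (Φ (V₁, z))) - Real.log (ρ' Ts (Φ (V₁, z)))) - (Real.log (ρ Ts (Φ (U₁, z))) - Real.log (ρ' Ts (Φ (U₁, z))))) * wN' s z| ≤ bD z) (hbDi : Integrable bD τ)
    {bS : Zc → ℝ} (hbS : ∀ᵐ z ∂τ, ∀ s ∈ U, |((Real.log (ρ Ts (Φ (V₁, z))) - Real.log (ρ' Ts (Φ (V₁, z)))) + (Real.log (ρ Ts (Φ (U₁, z))) - Real.log (ρ' Ts (Φ (U₁, z))))) * wN' s z| ≤ bS z) (hbSi : Integrable bS τ)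
    {bDS : Zc → ℝ} (hbDS : ∀ᵐ z ∂τ, ∀ s ∈ U, |(((Real.log (ρ Ts (Φ (V₁, z))) - Real.log (ρ' Ts (Φ (V₁, z)))) - (Real.log (ρ Ts (Φ (U₁, z))) - Real.log (ρ' Ts (Φ (U₁, z))))) * ((Real.log (ρ Ts (Φ (V₁, z))) - Real.log (ρ' Ts (Φ (V₁, z)))) + (Real.log (ρ Ts (Φ (U₁, z))) - Real.log (ρ' Ts (Φ (U₁, z)))))) * wN' s z| ≤ bDS z) (hbDSi : Integrable bDS τ)
    (hd : ∀ᵐ z ∂τ, ∀ s ∈ U, HasDerivAt (fun s => wNum F γ b₀ p₀ j Ts ρ ρ' Φ J t (X s) z) (wN' s z) s)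
    (hZ : ∀ s ∈ Icc (0:ℝ) 1, ∫ z, wNum F γ b₀ p₀ j Ts ρ ρ' Φ J t (X s) z ∂τ ≠ 0)
    (hnull : ∀ s ∈ Icc (0:ℝ) 1, ∀ᵐ z ∂τ, wNum F γ b₀ p₀ j Ts ρ ρ' Φ J t (X s) z = 0 → wN' s z = 0) {ℓ : ℝ}
    (hcum : ∀ s ∈ Icc (0:ℝ) 1,
      |(((∫ z, (((Real.log (ρ Ts (Φ (V₁, z))) - Real.log (ρ' Ts (Φ (V₁, z)))) - (Real.log (ρ Ts (Φ (U₁, z))) - Real.log (ρ' Ts (Φ (U₁, z))))) * ((Real.log (ρ Ts (Φ (V₁, z))) - Real.log (ρ' Ts (Φ (V₁, z)))) + (Real.log (ρ Ts (Φ (U₁, z))) - Real.log (ρ' Ts (Φ (U₁, z)))))) * (wN' s z / wNum F γ b₀ p₀ j Ts ρ ρ' Φ J t (X s) z) * (wNum F γ b₀ p₀ j Ts ρ ρ' Φ J t (X s) z / ∫ z', wNum F γ b₀ p₀ j Ts ρ ρ' Φ J t (X s) z' ∂τ) ∂τ)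
          - (∫ z, (((Real.log (ρ Ts (Φ (V₁, z))) - Real.log (ρ' Ts (Φ (V₁, z)))) - (Real.log (ρ Ts (Φ (U₁, z))) - Real.log (ρ' Ts (Φ (U₁, z))))) * ((Real.log (ρ Ts (Φ (V₁, z))) - Real.log (ρ' Ts (Φ (V₁, z)))) + (Real.log (ρ Ts (Φ (U₁, z))) - Real.log (ρ' Ts (Φ (U₁, z)))))) * (wNum F γ b₀ p₀ j Ts ρ ρ' Φ J t (X s) z / ∫ z', wNum F γ b₀ p₀ j Ts ρ ρ' Φ J t (X s) z' ∂τ) ∂τ) * (∫ z, (wN' s z / wNum F γ b₀ p₀ j Ts ρ ρ' Φ J t (X s) z) * (wNum F γ b₀ p₀ j Ts ρ ρ' Φ J t (X s) z / ∫ z', wNum F γ b₀ p₀ j Ts ρ ρ' Φ J t (X s) z' ∂τ) ∂τ))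
        - (((∫ z, ((Real.log (ρ Ts (Φ (V₁, z))) - Real.log (ρ' Ts (Φ (V₁, z)))) - (Real.log (ρ Ts (Φ (U₁, z))) - Real.log (ρ' Ts (Φ (U₁, z))))) * (wN' s z / wNum F γ b₀ p₀ j Ts ρ ρ' Φ J t (X s) z) * (wNum F γ b₀ p₀ j Ts ρ ρ' Φ J t (X s) z / ∫ z', wNum F γ b₀ p₀ j Ts ρ ρ' Φ J t (X s) z' ∂τ) ∂τ)
              - (∫ z, ((Real.log (ρ Ts (Φ (V₁, z))) - Real.log (ρ' Ts (Φ (V₁, z)))) - (Real.log (ρ Ts (Φ (U₁, z))) - Real.log (ρ' Ts (Φ (U₁, z))))) * (wNum F γ b₀ p₀ j Ts ρ ρ' Φ J t (X s) z / ∫ z', wNum F γ b₀ p₀ j Ts ρ ρ' Φ J t (X s) z' ∂τ) ∂τ) * (∫ z, (wN' s z / wNum F γ b₀ p₀ j Ts ρ ρ' Φ J t (X s) z) * (wNum F γ b₀ p₀ j Ts ρ ρ' Φ J t (X s) z / ∫ z', wNum F γ b₀ p₀ j Ts ρ ρ' Φ J t (X s) z' ∂τ) ∂τ))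
            * (∫ z, ((Real.log (ρ Ts (Φ (V₁, z))) - Real.log (ρ' Ts (Φ (V₁, z)))) + (Real.log (ρ Ts (Φ (U₁, z))) - Real.log (ρ' Ts (Φ (U₁, z))))) * (wNum F γ b₀ p₀ j Ts ρ ρ' Φ J t (X s) z / ∫ z', wNum F γ b₀ p₀ j Ts ρ ρ' Φ J t (X s) z' ∂τ) ∂τ)
          + (∫ z, ((Real.log (ρ Ts (Φ (V₁, z))) - Real.log (ρ' Ts (Φ (V₁, z)))) - (Real.log (ρ Ts (Φ (U₁, z))) - Real.log (ρ' Ts (Φ (U₁, z))))) * (wNum F γ b₀ p₀ j Ts ρ ρ' Φ J t (X s) z / ∫ z', wNum F γ b₀ p₀ j Ts ρ ρ' Φ J t (X s) z' ∂τ) ∂τ)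
            * ((∫ z, ((Real.log (ρ Ts (Φ (V₁, z))) - Real.log (ρ' Ts (Φ (V₁, z)))) + (Real.log (ρ Ts (Φ (U₁, z))) - Real.log (ρ' Ts (Φ (U₁, z))))) * (wN' s z / wNum F γ b₀ p₀ j Ts ρ ρ' Φ J t (X s) z) * (wNum F γ b₀ p₀ j Ts ρ ρ' Φ J t (X s) z / ∫ z', wNum F γ b₀ p₀ j Ts ρ ρ' Φ J t (X s) z' ∂τ) ∂τ)
              - (∫ z, ((Real.log (ρ Ts (Φ (V₁, z))) - Real.log (ρ' Ts (Φ (V₁, z)))) + (Real.log (ρ Ts (Φ (U₁, z))) - Real.log (ρ' Ts (Φ (U₁, z))))) * (wNum F γ b₀ p₀ j Ts ρ ρ' Φ J t (X s) z / ∫ z', wNum F γ b₀ p₀ j Ts ρ ρ' Φ J t (X s) z' ∂τ) ∂τ) * (∫ z, (wN' s z / wNum F γ b₀ p₀ j Ts ρ ρ' Φ J t (X s) z) * (wNum F γ b₀ p₀ j Ts ρ ρ' Φ J t (X s) z / ∫ z', wNum F γ b₀ p₀ j Ts ρ ρ' Φ J t (X s) z' ∂τ) ∂τ))))| ≤ ℓ)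 :
    ∀ (c₁ e₁ c₂ e₂ : ℝ), c₁ = ∫ z, ((Real.log (ρ Ts (Φ (V₁, z))) - Real.log (ρ' Ts (Φ (V₁, z)))) - (Real.log (ρ Ts (Φ (U₁, z))) - Real.log (ρ' Ts (Φ (U₁, z))))) * (wgt F γ b₀ p₀ j Ts ρ ρ' τ Φ J t) W₂ z ∂τ → e₁ = ∫ z, ((Real.log (ρ Ts (Φ (V₁, z))) - Real.log (ρ' Ts (Φ (V₁, z)))) + (Real.log (ρ Ts (Φ (U₁, z))) - Real.log (ρ' Ts (Φ (U₁, z))))) * (wgt F γ b₀ p₀ j Ts ρ ρ' τ Φ J t) W₂ z ∂τ →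
      c₂ = ∫ z, ((Real.log (ρ Ts (Φ (V₁, z))) - Real.log (ρ' Ts (Φ (V₁, z)))) - (Real.log (ρ Ts (Φ (U₁, z))) - Real.log (ρ' Ts (Φ (U₁, z))))) * (wgt F γ b₀ p₀ j Ts ρ ρ' τ Φ J t) U₂ z ∂τ → e₂ = ∫ z, ((Real.log (ρ Ts (Φ (V₁, z))) - Real.log (ρ' Ts (Φ (V₁, z)))) + (Real.log (ρ Ts (Φ (U₁, z))) - Real.log (ρ' Ts (Φ (U₁, z))))) * (wgt F γ b₀ p₀ j Ts ρ ρ' τ Φ J t) U₂ z ∂τ →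
      Integrable (fun z => (((Real.log (ρ Ts (Φ (V₁, z))) - Real.log (ρ' Ts (Φ (V₁, z)))) - (Real.log (ρ Ts (Φ (U₁, z))) - Real.log (ρ' Ts (Φ (U₁, z))))) - c₁) * (((Real.log (ρ Ts (Φ (V₁, z))) - Real.log (ρ' Ts (Φ (V₁, z)))) + (Real.log (ρ Ts (Φ (U₁, z))) - Real.log (ρ' Ts (Φ (U₁, z))))) - e₁) * (wgt F γ b₀ p₀ j Ts ρ ρ' τ Φ J t) W₂ z) τ ∧
      Integrable (fun z => (((Real.log (ρ Ts (Φ (V₁, z))) - Real.log (ρ' Ts (Φ (V₁, z)))) - (Real.log (ρ Ts (Φ (U₁, z))) - Real.log (ρ' Ts (Φ (U₁, z))))) - c₂) * (((Real.log (ρ Ts (Φ (V₁, z))) - Real.log (ρ' Ts (Φ (V₁, z)))) + (Real.log (ρ Ts (Φ (U₁, z))) - Real.log (ρ' Ts (Φ (U₁, z))))) - e₂) * (wgt F γ b₀ p₀ j Ts ρ ρ' τ Φ J t) U₂ z) τ ∧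
      |(∫ z, (((Real.log (ρ Ts (Φ (V₁, z))) - Real.log (ρ' Ts (Φ (V₁, z)))) - (Real.log (ρ Ts (Φ (U₁, z))) - Real.log (ρ' Ts (Φ (U₁, z))))) - c₁) * (((Real.log (ρ Ts (Φ (V₁, z))) - Real.log (ρ' Ts (Φ (V₁, z)))) + (Real.log (ρ Ts (Φ (U₁, z))) - Real.log (ρ' Ts (Φ (U₁, z))))) - e₁) * (wgt F γ b₀ p₀ j Ts ρ ρ' τ Φ J t) W₂ z ∂τ) - (∫ z, (((Real.log (ρ Ts (Φ (V₁, z))) - Real.log (ρ' Ts (Φ (V₁, z)))) - (Real.log (ρ Ts (Φ (U₁, z))) - Real.log (ρ' Ts (Φ (U₁, z))))) - c₂) * (((Real.log (ρ Ts (Φ (V₁, z))) - Real.log (ρ' Ts (Φ (V₁, z)))) + (Real.log (ρ Ts (Φ (U₁, z))) - Real.log (ρ' Ts (Φ (U₁, z))))) - e₂) * (wgt F γ b₀ p₀ j Ts ρ ρ' τ Φ J t) U₂ z ∂τ)| ≤ ℓ := by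
  intro c₁ e₁ c₂ e₂ hc₁ he₁ hc₂ he₂
  have h1 : (1:ℝ) ∈ Icc (0:ℝ) 1 := ⟨zero_le_one, le_rfl⟩
  have h0 : (0:ℝ) ∈ Icc (0:ℝ) 1 := ⟨le_rfl, zero_le_one⟩
  -- `wgt`-integrabilities and normalisation at the two endpoints
  have iDW := integrable_mul_wgt_of_wNum F γ b₀ p₀ j Ts ρ ρ' τ Φ J t (X 1) _ (hiD 1 h1)
  have iSW := integrable_mul_wgt_of_wNum F γ b₀ p₀ j Ts ρ ρ' τ Φ J t (X 1) _ (hiS 1 h1)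
  have iDSW := integrable_mul_wgt_of_wNum F γ b₀ p₀ j Ts ρ ρ' τ Φ J t (X 1) _ (hiDS 1 h1)
  have iDU := integrable_mul_wgt_of_wNum F γ b₀ p₀ j Ts ρ ρ' τ Φ J t (X 0) _ (hiD 0 h0)
  have iSU := integrable_mul_wgt_of_wNum F γ b₀ p₀ j Ts ρ ρ' τ Φ J t (X 0) _ (hiS 0 h0)
  have iDSU := integrable_mul_wgt_of_wNum F γ b₀ p₀ j Ts ρ ρ' τ Φ J t (X 0) _ (hiDS 0 h0)
  have iW1 : Integrable (fun z => (1:ℝ) * (wgt F γ b₀ p₀ j Ts ρ ρ' τ Φ J t) (X 1) z) τ :=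
    integrable_mul_wgt_of_wNum F γ b₀ p₀ j Ts ρ ρ' τ Φ J t (X 1) _ (by simpa only [one_mul] using hi 1 h1)
  have iW0 : Integrable (fun z => (1:ℝ) * (wgt F γ b₀ p₀ j Ts ρ ρ' τ Φ J t) (X 0) z) τ :=
    integrable_mul_wgt_of_wNum F γ b₀ p₀ j Ts ρ ρ' τ Φ J t (X 0) _ (by simpa only [one_mul] using hi 0 h0)
  simp only [one_mul] at iW1 iW0
  have n1 := integral_wgt_eq_one F γ b₀ p₀ j Ts ρ ρ' τ Φ J t (X 1) (hZ 1 h1)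
  have n0 := integral_wgt_eq_one F γ b₀ p₀ j Ts ρ ρ' τ Φ J t (X 0) (hZ 0 h0)
  rw [hX1] at iDW iSW iDSW iW1 n1
  rw [hX0] at iDU iSU iDSU iW0 n0
  -- the two `Integrable` conjuncts
  have I1 : Integrable (fun z => (((Real.log (ρ Ts (Φ (V₁, z))) - Real.log (ρ' Ts (Φ (V₁, z)))) - (Real.log (ρ Ts (Φ (U₁, z))) - Real.log (ρ' Ts (Φ (U₁, z))))) - c₁) * (((Real.log (ρ Ts (Φ (V₁, z))) - Real.log (ρ' Ts (Φ (V₁, z)))) + (Real.log (ρ Ts (Φ (U₁, z))) - Real.log (ρ' Ts (Φ (U₁, z))))) - e₁) * (wgt F γ b₀ p₀ j Ts ρ ρ' τ Φ J t) W₂ z) τ :=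
    integrable_centred_mul (A := fun z => ((Real.log (ρ Ts (Φ (V₁, z))) - Real.log (ρ' Ts (Φ (V₁, z)))) - (Real.log (ρ Ts (Φ (U₁, z))) - Real.log (ρ' Ts (Φ (U₁, z)))))) (B := fun z => ((Real.log (ρ Ts (Φ (V₁, z))) - Real.log (ρ' Ts (Φ (V₁, z)))) + (Real.log (ρ Ts (Φ (U₁, z))) - Real.log (ρ' Ts (Φ (U₁, z)))))) c₁ e₁ iDW iSW iDSW iW1
  have I2 : Integrable (fun z => (((Real.log (ρ Ts (Φ (V₁, z))) - Real.log (ρ' Ts (Φ (V₁, z)))) - (Real.log (ρ Ts (Φ (U₁, z))) - Real.log (ρ' Ts (Φ (U₁, z))))) - c₂) * (((Real.log (ρ Ts (Φ (V₁, z))) - Real.log (ρ' Ts (Φ (V₁, z)))) + (Real.log (ρ Ts (Φ (U₁, z))) - Real.log (ρ' Ts (Φ (U₁, z))))) - e₂) * (wgt F γ b₀ p₀ j Ts ρ ρ' τ Φ J t) U₂ z) τ :=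
    integrable_centred_mul (A := fun z => ((Real.log (ρ Ts (Φ (V₁, z))) - Real.log (ρ' Ts (Φ (V₁, z)))) - (Real.log (ρ Ts (Φ (U₁, z))) - Real.log (ρ' Ts (Φ (U₁, z)))))) (B := fun z => ((Real.log (ρ Ts (Φ (V₁, z))) - Real.log (ρ' Ts (Φ (V₁, z)))) + (Real.log (ρ Ts (Φ (U₁, z))) - Real.log (ρ' Ts (Φ (U₁, z)))))) c₂ e₂ iDU iSU iDSU iW0
  refine ⟨I1, I2, ?_⟩
  -- own centrings ↔ uncentred covariances
  have covW : (∫ z, (((Real.log (ρ Ts (Φ (V₁, z))) - Real.log (ρ' Ts (Φ (V₁, z)))) - (Real.log (ρ Ts (Φ (U₁, z))) - Real.log (ρ' Ts (Φ (U₁, z))))) - c₁) * (((Real.log (ρ Ts (Φ (V₁, z))) - Real.log (ρ' Ts (Φ (V₁, z)))) + (Real.log (ρ Ts (Φ (U₁, z))) - Real.log (ρ' Ts (Φ (U₁, z))))) - e₁) * (wgt F γ b₀ p₀ j Ts ρ ρ' τ Φ J t) W₂ z ∂τ)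
      = (∫ z, (((Real.log (ρ Ts (Φ (V₁, z))) - Real.log (ρ' Ts (Φ (V₁, z)))) - (Real.log (ρ Ts (Φ (U₁, z))) - Real.log (ρ' Ts (Φ (U₁, z))))) * ((Real.log (ρ Ts (Φ (V₁, z))) - Real.log (ρ' Ts (Φ (V₁, z)))) + (Real.log (ρ Ts (Φ (U₁, z))) - Real.log (ρ' Ts (Φ (U₁, z)))))) * (wgt F γ b₀ p₀ j Ts ρ ρ' τ Φ J t) W₂ z ∂τ) - (∫ z, ((Real.log (ρ Ts (Φ (V₁, z))) - Real.log (ρ' Ts (Φ (V₁, z)))) - (Real.log (ρ Ts (Φ (U₁, z))) - Real.log (ρ' Ts (Φ (U₁, z))))) * (wgt F γ b₀ p₀ j Ts ρ ρ' τ Φ J t) W₂ z ∂τ) * (∫ z, ((Real.log (ρ Ts (Φ (V₁, z))) - Real.log (ρ' Ts (Φ (V₁, z)))) + (Real.log (ρ Ts (Φ (U₁, z))) - Real.log (ρ' Ts (Φ (U₁, z))))) * (wgt F γ b₀ p₀ j Ts ρ ρ' τ Φ J t) W₂ z ∂τ) := by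
    rw [hc₁, he₁]
    exact integral_centred_mul_eq (A := fun z => ((Real.log (ρ Ts (Φ (V₁, z))) - Real.log (ρ' Ts (Φ (V₁, z)))) - (Real.log (ρ Ts (Φ (U₁, z))) - Real.log (ρ' Ts (Φ (U₁, z)))))) (B := fun z => ((Real.log (ρ Ts (Φ (V₁, z))) - Real.log (ρ' Ts (Φ (V₁, z)))) + (Real.log (ρ Ts (Φ (U₁, z))) - Real.log (ρ' Ts (Φ (U₁, z)))))) n1 iDW iSW iDSW iW1
  have covU : (∫ z, (((Real.log (ρ Ts (Φ (V₁, z))) - Real.log (ρ' Ts (Φ (V₁, z)))) - (Real.log (ρ Ts (Φ (U₁, z))) - Real.log (ρ' Ts (Φ (U₁, z))))) - c₂) * (((Real.log (ρ Ts (Φ (V₁, z))) - Real.log (ρ' Ts (Φ (V₁, z)))) + (Real.log (ρ Ts (Φ (U₁, z))) - Real.log (ρ' Ts (Φ (U₁, z))))) - e₂) * (wgt F γ b₀ p₀ j Ts ρ ρ' τ Φ J t) U₂ z ∂τ)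
      = (∫ z, (((Real.log (ρ Ts (Φ (V₁, z))) - Real.log (ρ' Ts (Φ (V₁, z)))) - (Real.log (ρ Ts (Φ (U₁, z))) - Real.log (ρ' Ts (Φ (U₁, z))))) * ((Real.log (ρ Ts (Φ (V₁, z))) - Real.log (ρ' Ts (Φ (V₁, z)))) + (Real.log (ρ Ts (Φ (U₁, z))) - Real.log (ρ' Ts (Φ (U₁, z)))))) * (wgt F γ b₀ p₀ j Ts ρ ρ' τ Φ J t) U₂ z ∂τ) - (∫ z, ((Real.log (ρ Ts (Φ (V₁, z))) - Real.log (ρ' Ts (Φ (V₁, z)))) - (Real.log (ρ Ts (Φ (U₁, z))) - Real.log (ρ' Ts (Φ (U₁, z))))) * (wgt F γ b₀ p₀ j Ts ρ ρ' τ Φ J t) U₂ z ∂τ) * (∫ z, ((Real.log (ρ Ts (Φ (V₁, z))) - Real.log (ρ' Ts (Φ (V₁, z)))) + (Real.log (ρ Ts (Φ (U₁, z))) - Real.log (ρ' Ts (Φ (U₁, z))))) * (wgt F γ b₀ p₀ j Ts ρ ρ' τ Φ J t) U₂ z ∂τ) := by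
    rw [hc₂, he₂]
    exact integral_centred_mul_eq (A := fun z => ((Real.log (ρ Ts (Φ (V₁, z))) - Real.log (ρ' Ts (Φ (V₁, z)))) - (Real.log (ρ Ts (Φ (U₁, z))) - Real.log (ρ' Ts (Φ (U₁, z)))))) (B := fun z => ((Real.log (ρ Ts (Φ (V₁, z))) - Real.log (ρ' Ts (Φ (V₁, z)))) + (Real.log (ρ Ts (Φ (U₁, z))) - Real.log (ρ' Ts (Φ (U₁, z)))))) n0 iDU iSU iDSU iW0
  rw [covW, covU]
  -- uncentred `wgt`-covariances in raw quotient form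
  rw [integral_mul_wgt_eq_div F γ b₀ p₀ j Ts ρ ρ' τ Φ J t W₂ (fun z => ((Real.log (ρ Ts (Φ (V₁, z))) - Real.log (ρ' Ts (Φ (V₁, z)))) - (Real.log (ρ Ts (Φ (U₁, z))) - Real.log (ρ' Ts (Φ (U₁, z))))) * ((Real.log (ρ Ts (Φ (V₁, z))) - Real.log (ρ' Ts (Φ (V₁, z)))) + (Real.log (ρ Ts (Φ (U₁, z))) - Real.log (ρ' Ts (Φ (U₁, z)))))),
    integral_mul_wgt_eq_div F γ b₀ p₀ j Ts ρ ρ' τ Φ J t W₂ (fun z => ((Real.log (ρ Ts (Φ (V₁, z))) - Real.log (ρ' Ts (Φ (V₁, z)))) - (Real.log (ρ Ts (Φ (U₁, z))) - Real.log (ρ' Ts (Φ (U₁, z)))))),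
    integral_mul_wgt_eq_div F γ b₀ p₀ j Ts ρ ρ' τ Φ J t W₂ (fun z => ((Real.log (ρ Ts (Φ (V₁, z))) - Real.log (ρ' Ts (Φ (V₁, z)))) + (Real.log (ρ Ts (Φ (U₁, z))) - Real.log (ρ' Ts (Φ (U₁, z)))))),
    integral_mul_wgt_eq_div F γ b₀ p₀ j Ts ρ ρ' τ Φ J t U₂ (fun z => ((Real.log (ρ Ts (Φ (V₁, z))) - Real.log (ρ' Ts (Φ (V₁, z)))) - (Real.log (ρ Ts (Φ (U₁, z))) - Real.log (ρ' Ts (Φ (U₁, z))))) * ((Real.log (ρ Ts (Φ (V₁, z))) - Real.log (ρ' Ts (Φ (V₁, z)))) + (Real.log (ρ Ts (Φ (U₁, z))) - Real.log (ρ' Ts (Φ (U₁, z)))))),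
    integral_mul_wgt_eq_div F γ b₀ p₀ j Ts ρ ρ' τ Φ J t U₂ (fun z => ((Real.log (ρ Ts (Φ (V₁, z))) - Real.log (ρ' Ts (Φ (V₁, z)))) - (Real.log (ρ Ts (Φ (U₁, z))) - Real.log (ρ' Ts (Φ (U₁, z)))))),
    integral_mul_wgt_eq_div F γ b₀ p₀ j Ts ρ ρ' τ Φ J t U₂ (fun z => ((Real.log (ρ Ts (Φ (V₁, z))) - Real.log (ρ' Ts (Φ (V₁, z)))) + (Real.log (ρ Ts (Φ (U₁, z))) - Real.log (ρ' Ts (Φ (U₁, z))))))]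
  -- the score kernel in (L23a)'s raw form, then the covariance edge along the path
  have hraw : ∀ s ∈ Icc (0:ℝ) 1,
      |((∫ z, (((Real.log (ρ Ts (Φ (V₁, z))) - Real.log (ρ' Ts (Φ (V₁, z)))) - (Real.log (ρ Ts (Φ (U₁, z))) - Real.log (ρ' Ts (Φ (U₁, z))))) * ((Real.log (ρ Ts (Φ (V₁, z))) - Real.log (ρ' Ts (Φ (V₁, z)))) + (Real.log (ρ Ts (Φ (U₁, z))) - Real.log (ρ' Ts (Φ (U₁, z)))))) * wN' s z ∂τ) / (∫ z, wNum F γ b₀ p₀ j Ts ρ ρ' Φ J t (X s) z ∂τ)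
          - ((∫ z, (((Real.log (ρ Ts (Φ (V₁, z))) - Real.log (ρ' Ts (Φ (V₁, z)))) - (Real.log (ρ Ts (Φ (U₁, z))) - Real.log (ρ' Ts (Φ (U₁, z))))) * ((Real.log (ρ Ts (Φ (V₁, z))) - Real.log (ρ' Ts (Φ (V₁, z)))) + (Real.log (ρ Ts (Φ (U₁, z))) - Real.log (ρ' Ts (Φ (U₁, z)))))) * wNum F γ b₀ p₀ j Ts ρ ρ' Φ J t (X s) z ∂τ) / (∫ z, wNum F γ b₀ p₀ j Ts ρ ρ' Φ J t (X s) z ∂τ)) * ((∫ z, wN' s z ∂τ) / (∫ z, wNum F γ b₀ p₀ j Ts ρ ρ' Φ J t (X s) z ∂τ)))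
        - (((∫ z, ((Real.log (ρ Ts (Φ (V₁, z))) - Real.log (ρ' Ts (Φ (V₁, z)))) - (Real.log (ρ Ts (Φ (U₁, z))) - Real.log (ρ' Ts (Φ (U₁, z))))) * wN' s z ∂τ) / (∫ z, wNum F γ b₀ p₀ j Ts ρ ρ' Φ J t (X s) z ∂τ)
              - ((∫ z, ((Real.log (ρ Ts (Φ (V₁, z))) - Real.log (ρ' Ts (Φ (V₁, z)))) - (Real.log (ρ Ts (Φ (U₁, z))) - Real.log (ρ' Ts (Φ (U₁, z))))) * wNum F γ b₀ p₀ j Ts ρ ρ' Φ J t (X s) z ∂τ) / (∫ z, wNum F γ b₀ p₀ j Ts ρ ρ' Φ J t (X s) z ∂τ)) * ((∫ z, wN' s z ∂τ) / (∫ z, wNum F γ b₀ p₀ j Ts ρ ρ' Φ J t (X s) z ∂τ)))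
            * ((∫ z, ((Real.log (ρ Ts (Φ (V₁, z))) - Real.log (ρ' Ts (Φ (V₁, z)))) + (Real.log (ρ Ts (Φ (U₁, z))) - Real.log (ρ' Ts (Φ (U₁, z))))) * wNum F γ b₀ p₀ j Ts ρ ρ' Φ J t (X s) z ∂τ) / (∫ z, wNum F γ b₀ p₀ j Ts ρ ρ' Φ J t (X s) z ∂τ))
          + ((∫ z, ((Real.log (ρ Ts (Φ (V₁, z))) - Real.log (ρ' Ts (Φ (V₁, z)))) - (Real.log (ρ Ts (Φ (U₁, z))) - Real.log (ρ' Ts (Φ (U₁, z))))) * wNum F γ b₀ p₀ j Ts ρ ρ' Φ J t (X s) z ∂τ) / (∫ z, wNum F γ b₀ p₀ j Ts ρ ρ' Φ J t (X s) z ∂τ))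
            * ((∫ z, ((Real.log (ρ Ts (Φ (V₁, z))) - Real.log (ρ' Ts (Φ (V₁, z)))) + (Real.log (ρ Ts (Φ (U₁, z))) - Real.log (ρ' Ts (Φ (U₁, z))))) * wN' s z ∂τ) / (∫ z, wNum F γ b₀ p₀ j Ts ρ ρ' Φ J t (X s) z ∂τ)
              - ((∫ z, ((Real.log (ρ Ts (Φ (V₁, z))) - Real.log (ρ' Ts (Φ (V₁, z)))) + (Real.log (ρ Ts (Φ (U₁, z))) - Real.log (ρ' Ts (Φ (U₁, z))))) * wNum F γ b₀ p₀ j Ts ρ ρ' Φ J t (X s) z ∂τ) / (∫ z, wNum F γ b₀ p₀ j Ts ρ ρ' Φ J t (X s) z ∂τ)) * ((∫ z, wN' s z ∂τ) / (∫ z, wNum F γ b₀ p₀ j Ts ρ ρ' Φ J t (X s) z ∂τ))))| ≤ ℓ := by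
    intro s hs
    rw [normCov_deriv_eq_cum3_of_null (w := fun s z => wNum F γ b₀ p₀ j Ts ρ ρ' Φ J t (X s) z) (w' := wN') (A := fun z => ((Real.log (ρ Ts (Φ (V₁, z))) - Real.log (ρ' Ts (Φ (V₁, z)))) - (Real.log (ρ Ts (Φ (U₁, z))) - Real.log (ρ' Ts (Φ (U₁, z)))))) (B := fun z => ((Real.log (ρ Ts (Φ (V₁, z))) - Real.log (ρ' Ts (Φ (V₁, z)))) + (Real.log (ρ Ts (Φ (U₁, z))) - Real.log (ρ' Ts (Φ (U₁, z)))))) (s₀ := s) (hnull s hs)]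
    exact hcum s hs
  have hedge := abs_normCov_one_sub_zero_le (w := fun s z => wNum F γ b₀ p₀ j Ts ρ ρ' Φ J t (X s) z) (w' := wN') (A := fun z => ((Real.log (ρ Ts (Φ (V₁, z))) - Real.log (ρ' Ts (Φ (V₁, z)))) - (Real.log (ρ Ts (Φ (U₁, z))) - Real.log (ρ' Ts (Φ (U₁, z)))))) (B := fun z => ((Real.log (ρ Ts (Φ (V₁, z))) - Real.log (ρ' Ts (Φ (V₁, z)))) + (Real.log (ρ Ts (Φ (U₁, z))) - Real.log (ρ' Ts (Φ (U₁, z)))))) hU hUI hmD hmS hm hm'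
    hi hiD hiS hiDS hb hbi hbD hbDi hbS hbSi hbDS hbDSi hd hZ hraw
  rw [hX0, hX1] at hedge
  exact hedge

end CovEdge


/-! ## §3 (JV4-h′): the law square of an own-centred variance -/

section VarSquare

/-- ★★★ **THE D4 LAW-SIDE BRICK FOR (JV4-h′)** (see the module docstring): ANY two-parameter law path `X` with corners `V00 V10 V01 V11`, ✓(L26a) `abs_normVar_secondDiff_le`'s
data for `w s s′ z := wNum … t (X s s′) z` and the frozen `F = F_{V00}` (partial families `w₁ w₂ w₁₂`, nine dominators on an open `U ⊇ [0,1]`, masses `≠ 0`), the seven path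
functionals `φ … ψ₁₂` as binders with their defining equations, and the kernel `|ψ₁₂ − 2(φ₁φ₂ + φφ₁₂)| ≤ ℓ` on `[0,1]²` ⟹ the (JV4-h′) body of ✓p814004 VERBATIM. [folklore] -/
theorem varSquareClause_of_mixedKernel (F : T3Family) (γ b₀ p₀ : ℝ) (j Ts : ℕ)
    (ρ ρ' : (i : ℕ) → GaugeField (F.P i) 0 ↥(Matrix.specialUnitaryGroup (Fin 2) ℂ) → ℝ) {Zc : Type} [MeasurableSpace Zc] (τ : Measure Zc)
    (Φ : GaugeField (F.P j) 0 ↥(Matrix.specialUnitaryGroup (Fin 2) ℂ) × Zc → GaugeField (F.P Ts) 0 ↥(Matrix.specialUnitaryGroup (Fin 2) ℂ))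
    (J : GaugeField (F.P j) 0 ↥(Matrix.specialUnitaryGroup (Fin 2) ℂ) × Zc → NNReal) (t : ℝ)
    (V00 V10 V01 V11 : GaugeField (F.P j) 0 ↥(Matrix.specialUnitaryGroup (Fin 2) ℂ))
    (X : ℝ → ℝ → GaugeField (F.P j) 0 ↥(Matrix.specialUnitaryGroup (Fin 2) ℂ)) (hX00 : X 0 0 = V00) (hX10 : X 1 0 = V10) (hX01 : X 0 1 = V01)
    (hX11 : X 1 1 = V11) (w₁ w₂ w₁₂ : ℝ → ℝ → Zc → ℝ) {U : Set ℝ} (hU : IsOpen U) (hUI : Icc (0:ℝ) 1 ⊆ U)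
    (hmF : AEStronglyMeasurable (fun z => (Real.log (ρ Ts (Φ (V00, z))) - Real.log (ρ' Ts (Φ (V00, z))))) τ)
    (hm : ∀ s s', AEStronglyMeasurable (fun z => wNum F γ b₀ p₀ j Ts ρ ρ' Φ J t (X s s') z) τ)
    (hm₁ : ∀ s s', AEStronglyMeasurable (w₁ s s') τ) (hm₂ : ∀ s s', AEStronglyMeasurable (w₂ s s') τ) (hm₁₂ : ∀ s s', AEStronglyMeasurable (w₁₂ s s') τ)
    (hi : ∀ s ∈ Icc (0:ℝ) 1, ∀ s' ∈ Icc (0:ℝ) 1, Integrable (fun z => wNum F γ b₀ p₀ j Ts ρ ρ' Φ J t (X s s') z) τ)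
    (hiF : ∀ s ∈ Icc (0:ℝ) 1, ∀ s' ∈ Icc (0:ℝ) 1, Integrable (fun z => (Real.log (ρ Ts (Φ (V00, z))) - Real.log (ρ' Ts (Φ (V00, z)))) * wNum F γ b₀ p₀ j Ts ρ ρ' Φ J t (X s s') z) τ)
    (hiFF : ∀ s ∈ Icc (0:ℝ) 1, ∀ s' ∈ Icc (0:ℝ) 1, Integrable (fun z => ((Real.log (ρ Ts (Φ (V00, z))) - Real.log (ρ' Ts (Φ (V00, z)))) * (Real.log (ρ Ts (Φ (V00, z))) - Real.log (ρ' Ts (Φ (V00, z))))) * wNum F γ b₀ p₀ j Ts ρ ρ' Φ J t (X s s') z) τ)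
    (hi₂ : ∀ s ∈ Icc (0:ℝ) 1, ∀ s' ∈ Icc (0:ℝ) 1, Integrable (w₂ s s') τ)
    (hiF₂ : ∀ s ∈ Icc (0:ℝ) 1, ∀ s' ∈ Icc (0:ℝ) 1, Integrable (fun z => (Real.log (ρ Ts (Φ (V00, z))) - Real.log (ρ' Ts (Φ (V00, z)))) * w₂ s s' z) τ)
    (hiFF₂ : ∀ s ∈ Icc (0:ℝ) 1, ∀ s' ∈ Icc (0:ℝ) 1, Integrable (fun z => ((Real.log (ρ Ts (Φ (V00, z))) - Real.log (ρ' Ts (Φ (V00, z)))) * (Real.log (ρ Ts (Φ (V00, z))) - Real.log (ρ' Ts (Φ (V00, z))))) * w₂ s s' z) τ)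
    {b₁ : Zc → ℝ} (hb₁ : ∀ᵐ z ∂τ, ∀ s ∈ U, ∀ s' ∈ U, |w₁ s s' z| ≤ b₁ z) (hb₁i : Integrable b₁ τ)
    {b₁F : Zc → ℝ} (hb₁F : ∀ᵐ z ∂τ, ∀ s ∈ U, ∀ s' ∈ U, |(Real.log (ρ Ts (Φ (V00, z))) - Real.log (ρ' Ts (Φ (V00, z)))) * w₁ s s' z| ≤ b₁F z) (hb₁Fi : Integrable b₁F τ)
    {b₁FF : Zc → ℝ} (hb₁FF : ∀ᵐ z ∂τ, ∀ s ∈ U, ∀ s' ∈ U, |((Real.log (ρ Ts (Φ (V00, z))) - Real.log (ρ' Ts (Φ (V00, z)))) * (Real.log (ρ Ts (Φ (V00, z))) - Real.log (ρ' Ts (Φ (V00, z))))) * w₁ s s' z| ≤ b₁FF z) (hb₁FFi : Integrable b₁FF τ)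
    {b₂ : Zc → ℝ} (hb₂ : ∀ᵐ z ∂τ, ∀ s ∈ U, ∀ s' ∈ U, |w₂ s s' z| ≤ b₂ z) (hb₂i : Integrable b₂ τ)
    {b₂F : Zc → ℝ} (hb₂F : ∀ᵐ z ∂τ, ∀ s ∈ U, ∀ s' ∈ U, |(Real.log (ρ Ts (Φ (V00, z))) - Real.log (ρ' Ts (Φ (V00, z)))) * w₂ s s' z| ≤ b₂F z) (hb₂Fi : Integrable b₂F τ)
    {b₂FF : Zc → ℝ} (hb₂FF : ∀ᵐ z ∂τ, ∀ s ∈ U, ∀ s' ∈ U, |((Real.log (ρ Ts (Φ (V00, z))) - Real.log (ρ' Ts (Φ (V00, z)))) * (Real.log (ρ Ts (Φ (V00, z))) - Real.log (ρ' Ts (Φ (V00, z))))) * w₂ s s' z| ≤ b₂FF z) (hb₂FFi : Integrable b₂FF τ)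
    {b₁₂ : Zc → ℝ} (hb₁₂ : ∀ᵐ z ∂τ, ∀ s ∈ U, ∀ s' ∈ U, |w₁₂ s s' z| ≤ b₁₂ z) (hb₁₂i : Integrable b₁₂ τ)
    {b₁₂F : Zc → ℝ} (hb₁₂F : ∀ᵐ z ∂τ, ∀ s ∈ U, ∀ s' ∈ U, |(Real.log (ρ Ts (Φ (V00, z))) - Real.log (ρ' Ts (Φ (V00, z)))) * w₁₂ s s' z| ≤ b₁₂F z) (hb₁₂Fi : Integrable b₁₂F τ)
    {b₁₂FF : Zc → ℝ} (hb₁₂FF : ∀ᵐ z ∂τ, ∀ s ∈ U, ∀ s' ∈ U, |((Real.log (ρ Ts (Φ (V00, z))) - Real.log (ρ' Ts (Φ (V00, z)))) * (Real.log (ρ Ts (Φ (V00, z))) - Real.log (ρ' Ts (Φ (V00, z))))) * w₁₂ s s' z| ≤ b₁₂FF z) (hb₁₂FFi : Integrable b₁₂FF τ)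
    (hd₂ : ∀ᵐ z ∂τ, ∀ s ∈ U, ∀ s' ∈ U, HasDerivAt (fun s' => wNum F γ b₀ p₀ j Ts ρ ρ' Φ J t (X s s') z) (w₂ s s' z) s')
    (hd₁ : ∀ᵐ z ∂τ, ∀ s ∈ U, ∀ s' ∈ U, HasDerivAt (fun s => wNum F γ b₀ p₀ j Ts ρ ρ' Φ J t (X s s') z) (w₁ s s' z) s)
    (hd₁₂ : ∀ᵐ z ∂τ, ∀ s ∈ U, ∀ s' ∈ U, HasDerivAt (fun s => w₂ s s' z) (w₁₂ s s' z) s)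
    (hZ : ∀ s ∈ Icc (0:ℝ) 1, ∀ s' ∈ Icc (0:ℝ) 1, (∫ z, wNum F γ b₀ p₀ j Ts ρ ρ' Φ J t (X s s') z ∂τ) ≠ 0)
    (φ φ₁ φ₂ φ₁₂ ψ ψ₂ ψ₁₂ : ℝ → ℝ → ℝ)
    (hφ : ∀ s s', φ s s' = (∫ z, (Real.log (ρ Ts (Φ (V00, z))) - Real.log (ρ' Ts (Φ (V00, z)))) * wNum F γ b₀ p₀ j Ts ρ ρ' Φ J t (X s s') z ∂τ) / (∫ z, wNum F γ b₀ p₀ j Ts ρ ρ' Φ J t (X s s') z ∂τ))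
    (hφ₁ : ∀ s s', φ₁ s s' = (∫ z, (Real.log (ρ Ts (Φ (V00, z))) - Real.log (ρ' Ts (Φ (V00, z)))) * w₁ s s' z ∂τ) / (∫ z, wNum F γ b₀ p₀ j Ts ρ ρ' Φ J t (X s s') z ∂τ)
      - ((∫ z, (Real.log (ρ Ts (Φ (V00, z))) - Real.log (ρ' Ts (Φ (V00, z)))) * wNum F γ b₀ p₀ j Ts ρ ρ' Φ J t (X s s') z ∂τ) / (∫ z, wNum F γ b₀ p₀ j Ts ρ ρ' Φ J t (X s s') z ∂τ)) * ((∫ z, w₁ s s' z ∂τ) / (∫ z, wNum F γ b₀ p₀ j Ts ρ ρ' Φ J t (X s s') z ∂τ)))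
    (hφ₂ : ∀ s s', φ₂ s s' = (∫ z, (Real.log (ρ Ts (Φ (V00, z))) - Real.log (ρ' Ts (Φ (V00, z)))) * w₂ s s' z ∂τ) / (∫ z, wNum F γ b₀ p₀ j Ts ρ ρ' Φ J t (X s s') z ∂τ)
      - ((∫ z, (Real.log (ρ Ts (Φ (V00, z))) - Real.log (ρ' Ts (Φ (V00, z)))) * wNum F γ b₀ p₀ j Ts ρ ρ' Φ J t (X s s') z ∂τ) / (∫ z, wNum F γ b₀ p₀ j Ts ρ ρ' Φ J t (X s s') z ∂τ)) * ((∫ z, w₂ s s' z ∂τ) / (∫ z, wNum F γ b₀ p₀ j Ts ρ ρ' Φ J t (X s s') z ∂τ)))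
    (hφ₁₂ : ∀ s s', φ₁₂ s s' = ((∫ z, (Real.log (ρ Ts (Φ (V00, z))) - Real.log (ρ' Ts (Φ (V00, z)))) * w₁₂ s s' z ∂τ) / (∫ z, wNum F γ b₀ p₀ j Ts ρ ρ' Φ J t (X s s') z ∂τ)
          - ((∫ z, (Real.log (ρ Ts (Φ (V00, z))) - Real.log (ρ' Ts (Φ (V00, z)))) * w₂ s s' z ∂τ) / (∫ z, wNum F γ b₀ p₀ j Ts ρ ρ' Φ J t (X s s') z ∂τ)) * ((∫ z, w₁ s s' z ∂τ) / (∫ z, wNum F γ b₀ p₀ j Ts ρ ρ' Φ J t (X s s') z ∂τ)))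
        - ((((∫ z, (Real.log (ρ Ts (Φ (V00, z))) - Real.log (ρ' Ts (Φ (V00, z)))) * w₁ s s' z ∂τ) / (∫ z, wNum F γ b₀ p₀ j Ts ρ ρ' Φ J t (X s s') z ∂τ)
              - ((∫ z, (Real.log (ρ Ts (Φ (V00, z))) - Real.log (ρ' Ts (Φ (V00, z)))) * wNum F γ b₀ p₀ j Ts ρ ρ' Φ J t (X s s') z ∂τ) / (∫ z, wNum F γ b₀ p₀ j Ts ρ ρ' Φ J t (X s s') z ∂τ)) * ((∫ z, w₁ s s' z ∂τ) / (∫ z, wNum F γ b₀ p₀ j Ts ρ ρ' Φ J t (X s s') z ∂τ)))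
            * ((∫ z, w₂ s s' z ∂τ) / (∫ z, wNum F γ b₀ p₀ j Ts ρ ρ' Φ J t (X s s') z ∂τ)))
          + ((∫ z, (Real.log (ρ Ts (Φ (V00, z))) - Real.log (ρ' Ts (Φ (V00, z)))) * wNum F γ b₀ p₀ j Ts ρ ρ' Φ J t (X s s') z ∂τ) / (∫ z, wNum F γ b₀ p₀ j Ts ρ ρ' Φ J t (X s s') z ∂τ))
            * ((∫ z, w₁₂ s s' z ∂τ) / (∫ z, wNum F γ b₀ p₀ j Ts ρ ρ' Φ J t (X s s') z ∂τ)
              - ((∫ z, w₂ s s' z ∂τ) / (∫ z, wNum F γ b₀ p₀ j Ts ρ ρ' Φ J t (X s s') z ∂τ)) * ((∫ z, w₁ s s' z ∂τ) / (∫ z, wNum F γ b₀ p₀ j Ts ρ ρ' Φ J t (X s s') z ∂τ)))))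
    (hψ : ∀ s s', ψ s s' = (∫ z, ((Real.log (ρ Ts (Φ (V00, z))) - Real.log (ρ' Ts (Φ (V00, z)))) * (Real.log (ρ Ts (Φ (V00, z))) - Real.log (ρ' Ts (Φ (V00, z))))) * wNum F γ b₀ p₀ j Ts ρ ρ' Φ J t (X s s') z ∂τ) / (∫ z, wNum F γ b₀ p₀ j Ts ρ ρ' Φ J t (X s s') z ∂τ))
    (hψ₂ : ∀ s s', ψ₂ s s' = (∫ z, ((Real.log (ρ Ts (Φ (V00, z))) - Real.log (ρ' Ts (Φ (V00, z)))) * (Real.log (ρ Ts (Φ (V00, z))) - Real.log (ρ' Ts (Φ (V00, z))))) * w₂ s s' z ∂τ) / (∫ z, wNum F γ b₀ p₀ j Ts ρ ρ' Φ J t (X s s') z ∂τ)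
      - ((∫ z, ((Real.log (ρ Ts (Φ (V00, z))) - Real.log (ρ' Ts (Φ (V00, z)))) * (Real.log (ρ Ts (Φ (V00, z))) - Real.log (ρ' Ts (Φ (V00, z))))) * wNum F γ b₀ p₀ j Ts ρ ρ' Φ J t (X s s') z ∂τ) / (∫ z, wNum F γ b₀ p₀ j Ts ρ ρ' Φ J t (X s s') z ∂τ)) * ((∫ z, w₂ s s' z ∂τ) / (∫ z, wNum F γ b₀ p₀ j Ts ρ ρ' Φ J t (X s s') z ∂τ)))
    (hψ₁₂ : ∀ s s', ψ₁₂ s s' = ((∫ z, ((Real.log (ρ Ts (Φ (V00, z))) - Real.log (ρ' Ts (Φ (V00, z)))) * (Real.log (ρ Ts (Φ (V00, z))) - Real.log (ρ' Ts (Φ (V00, z))))) * w₁₂ s s' z ∂τ) / (∫ z, wNum F γ b₀ p₀ j Ts ρ ρ' Φ J t (X s s') z ∂τ)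
          - ((∫ z, ((Real.log (ρ Ts (Φ (V00, z))) - Real.log (ρ' Ts (Φ (V00, z)))) * (Real.log (ρ Ts (Φ (V00, z))) - Real.log (ρ' Ts (Φ (V00, z))))) * w₂ s s' z ∂τ) / (∫ z, wNum F γ b₀ p₀ j Ts ρ ρ' Φ J t (X s s') z ∂τ)) * ((∫ z, w₁ s s' z ∂τ) / (∫ z, wNum F γ b₀ p₀ j Ts ρ ρ' Φ J t (X s s') z ∂τ)))
        - ((((∫ z, ((Real.log (ρ Ts (Φ (V00, z))) - Real.log (ρ' Ts (Φ (V00, z)))) * (Real.log (ρ Ts (Φ (V00, z))) - Real.log (ρ' Ts (Φ (V00, z))))) * w₁ s s' z ∂τ) / (∫ z, wNum F γ b₀ p₀ j Ts ρ ρ' Φ J t (X s s') z ∂τ)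
              - ((∫ z, ((Real.log (ρ Ts (Φ (V00, z))) - Real.log (ρ' Ts (Φ (V00, z)))) * (Real.log (ρ Ts (Φ (V00, z))) - Real.log (ρ' Ts (Φ (V00, z))))) * wNum F γ b₀ p₀ j Ts ρ ρ' Φ J t (X s s') z ∂τ) / (∫ z, wNum F γ b₀ p₀ j Ts ρ ρ' Φ J t (X s s') z ∂τ)) * ((∫ z, w₁ s s' z ∂τ) / (∫ z, wNum F γ b₀ p₀ j Ts ρ ρ' Φ J t (X s s') z ∂τ)))
            * ((∫ z, w₂ s s' z ∂τ) / (∫ z, wNum F γ b₀ p₀ j Ts ρ ρ' Φ J t (X s s') z ∂τ)))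
          + ((∫ z, ((Real.log (ρ Ts (Φ (V00, z))) - Real.log (ρ' Ts (Φ (V00, z)))) * (Real.log (ρ Ts (Φ (V00, z))) - Real.log (ρ' Ts (Φ (V00, z))))) * wNum F γ b₀ p₀ j Ts ρ ρ' Φ J t (X s s') z ∂τ) / (∫ z, wNum F γ b₀ p₀ j Ts ρ ρ' Φ J t (X s s') z ∂τ))
            * ((∫ z, w₁₂ s s' z ∂τ) / (∫ z, wNum F γ b₀ p₀ j Ts ρ ρ' Φ J t (X s s') z ∂τ)
              - ((∫ z, w₂ s s' z ∂τ) / (∫ z, wNum F γ b₀ p₀ j Ts ρ ρ' Φ J t (X s s') z ∂τ)) * ((∫ z, w₁ s s' z ∂τ) / (∫ z, wNum F γ b₀ p₀ j Ts ρ ρ' Φ J t (X s s') z ∂τ)))))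
    {ℓ : ℝ} (hker : ∀ s ∈ Icc (0:ℝ) 1, ∀ s' ∈ Icc (0:ℝ) 1, |ψ₁₂ s s' - 2 * (φ₁ s s' * φ₂ s s' + φ s s' * φ₁₂ s s')| ≤ ℓ) :
    ∀ (c₀₀ c₁₀ c₀₁ c₁₁ : ℝ), c₀₀ = ∫ z, (Real.log (ρ Ts (Φ (V00, z))) - Real.log (ρ' Ts (Φ (V00, z)))) * (wgt F γ b₀ p₀ j Ts ρ ρ' τ Φ J t) V00 z ∂τ → c₁₀ = ∫ z, (Real.log (ρ Ts (Φ (V00, z))) - Real.log (ρ' Ts (Φ (V00, z)))) * (wgt F γ b₀ p₀ j Ts ρ ρ' τ Φ J t) V10 z ∂τ →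
      c₀₁ = ∫ z, (Real.log (ρ Ts (Φ (V00, z))) - Real.log (ρ' Ts (Φ (V00, z)))) * (wgt F γ b₀ p₀ j Ts ρ ρ' τ Φ J t) V01 z ∂τ → c₁₁ = ∫ z, (Real.log (ρ Ts (Φ (V00, z))) - Real.log (ρ' Ts (Φ (V00, z)))) * (wgt F γ b₀ p₀ j Ts ρ ρ' τ Φ J t) V11 z ∂τ →
      Integrable (fun z => ((Real.log (ρ Ts (Φ (V00, z))) - Real.log (ρ' Ts (Φ (V00, z)))) - c₀₀) ^ 2 * (wgt F γ b₀ p₀ j Ts ρ ρ' τ Φ J t) V00 z) τ ∧ Integrable (fun z => ((Real.log (ρ Ts (Φ (V00, z))) - Real.log (ρ' Ts (Φ (V00, z)))) - c₁₀) ^ 2 * (wgt F γ b₀ p₀ j Ts ρ ρ' τ Φ J t) V10 z) τ ∧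
      Integrable (fun z => ((Real.log (ρ Ts (Φ (V00, z))) - Real.log (ρ' Ts (Φ (V00, z)))) - c₀₁) ^ 2 * (wgt F γ b₀ p₀ j Ts ρ ρ' τ Φ J t) V01 z) τ ∧ Integrable (fun z => ((Real.log (ρ Ts (Φ (V00, z))) - Real.log (ρ' Ts (Φ (V00, z)))) - c₁₁) ^ 2 * (wgt F γ b₀ p₀ j Ts ρ ρ' τ Φ J t) V11 z) τ ∧
      |(∫ z, ((Real.log (ρ Ts (Φ (V00, z))) - Real.log (ρ' Ts (Φ (V00, z)))) - c₁₁) ^ 2 * (wgt F γ b₀ p₀ j Ts ρ ρ' τ Φ J t) V11 z ∂τ) - (∫ z, ((Real.log (ρ Ts (Φ (V00, z))) - Real.log (ρ' Ts (Φ (V00, z)))) - c₁₀) ^ 2 * (wgt F γ b₀ p₀ j Ts ρ ρ' τ Φ J t) V10 z ∂τ)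
        - (∫ z, ((Real.log (ρ Ts (Φ (V00, z))) - Real.log (ρ' Ts (Φ (V00, z)))) - c₀₁) ^ 2 * (wgt F γ b₀ p₀ j Ts ρ ρ' τ Φ J t) V01 z ∂τ) + (∫ z, ((Real.log (ρ Ts (Φ (V00, z))) - Real.log (ρ' Ts (Φ (V00, z)))) - c₀₀) ^ 2 * (wgt F γ b₀ p₀ j Ts ρ ρ' τ Φ J t) V00 z ∂τ)| ≤ ℓ := by
  intro c₀₀ c₁₀ c₀₁ c₁₁ hc₀₀ hc₁₀ hc₀₁ hc₁₁
  have h1 : (1:ℝ) ∈ Icc (0:ℝ) 1 := ⟨zero_le_one, le_rfl⟩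
  have h0 : (0:ℝ) ∈ Icc (0:ℝ) 1 := ⟨le_rfl, zero_le_one⟩
  -- monomial `wgt`-integrabilities and normalisation at the four corners
  have iF00 := integrable_mul_wgt_of_wNum F γ b₀ p₀ j Ts ρ ρ' τ Φ J t (X 0 0) _ (hiF 0 h0 0 h0)
  have iF10 := integrable_mul_wgt_of_wNum F γ b₀ p₀ j Ts ρ ρ' τ Φ J t (X 1 0) _ (hiF 1 h1 0 h0)
  have iF01 := integrable_mul_wgt_of_wNum F γ b₀ p₀ j Ts ρ ρ' τ Φ J t (X 0 1) _ (hiF 0 h0 1 h1)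
  have iF11 := integrable_mul_wgt_of_wNum F γ b₀ p₀ j Ts ρ ρ' τ Φ J t (X 1 1) _ (hiF 1 h1 1 h1)
  have iFF00 := integrable_mul_wgt_of_wNum F γ b₀ p₀ j Ts ρ ρ' τ Φ J t (X 0 0) _ (hiFF 0 h0 0 h0)
  have iFF10 := integrable_mul_wgt_of_wNum F γ b₀ p₀ j Ts ρ ρ' τ Φ J t (X 1 0) _ (hiFF 1 h1 0 h0)
  have iFF01 := integrable_mul_wgt_of_wNum F γ b₀ p₀ j Ts ρ ρ' τ Φ J t (X 0 1) _ (hiFF 0 h0 1 h1)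
  have iFF11 := integrable_mul_wgt_of_wNum F γ b₀ p₀ j Ts ρ ρ' τ Φ J t (X 1 1) _ (hiFF 1 h1 1 h1)
  have iW00 : Integrable (fun z => (1:ℝ) * (wgt F γ b₀ p₀ j Ts ρ ρ' τ Φ J t) (X 0 0) z) τ :=
    integrable_mul_wgt_of_wNum F γ b₀ p₀ j Ts ρ ρ' τ Φ J t (X 0 0) _ (by simpa only [one_mul] using hi 0 h0 0 h0)
  have iW10 : Integrable (fun z => (1:ℝ) * (wgt F γ b₀ p₀ j Ts ρ ρ' τ Φ J t) (X 1 0) z) τ :=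
    integrable_mul_wgt_of_wNum F γ b₀ p₀ j Ts ρ ρ' τ Φ J t (X 1 0) _ (by simpa only [one_mul] using hi 1 h1 0 h0)
  have iW01 : Integrable (fun z => (1:ℝ) * (wgt F γ b₀ p₀ j Ts ρ ρ' τ Φ J t) (X 0 1) z) τ :=
    integrable_mul_wgt_of_wNum F γ b₀ p₀ j Ts ρ ρ' τ Φ J t (X 0 1) _ (by simpa only [one_mul] using hi 0 h0 1 h1)
  have iW11 : Integrable (fun z => (1:ℝ) * (wgt F γ b₀ p₀ j Ts ρ ρ' τ Φ J t) (X 1 1) z) τ :=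
    integrable_mul_wgt_of_wNum F γ b₀ p₀ j Ts ρ ρ' τ Φ J t (X 1 1) _ (by simpa only [one_mul] using hi 1 h1 1 h1)
  simp only [one_mul] at iW00 iW10 iW01 iW11
  have n00 := integral_wgt_eq_one F γ b₀ p₀ j Ts ρ ρ' τ Φ J t (X 0 0) (hZ 0 h0 0 h0)
  have n10 := integral_wgt_eq_one F γ b₀ p₀ j Ts ρ ρ' τ Φ J t (X 1 0) (hZ 1 h1 0 h0)
  have n01 := integral_wgt_eq_one F γ b₀ p₀ j Ts ρ ρ' τ Φ J t (X 0 1) (hZ 0 h0 1 h1)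
  have n11 := integral_wgt_eq_one F γ b₀ p₀ j Ts ρ ρ' τ Φ J t (X 1 1) (hZ 1 h1 1 h1)
  rw [hX00] at iF00 iFF00 iW00 n00
  rw [hX10] at iF10 iFF10 iW10 n10
  rw [hX01] at iF01 iFF01 iW01 n01
  rw [hX11] at iF11 iFF11 iW11 n11
  refine ⟨integrable_centred_sq (A := fun z => (Real.log (ρ Ts (Φ (V00, z))) - Real.log (ρ' Ts (Φ (V00, z))))) c₀₀ iF00 iFF00 iW00, integrable_centred_sq (A := fun z => (Real.log (ρ Ts (Φ (V00, z))) - Real.log (ρ' Ts (Φ (V00, z))))) c₁₀ iF10 iFF10 iW10,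
    integrable_centred_sq (A := fun z => (Real.log (ρ Ts (Φ (V00, z))) - Real.log (ρ' Ts (Φ (V00, z))))) c₀₁ iF01 iFF01 iW01, integrable_centred_sq (A := fun z => (Real.log (ρ Ts (Φ (V00, z))) - Real.log (ρ' Ts (Φ (V00, z))))) c₁₁ iF11 iFF11 iW11, ?_⟩
  -- own-centred variances ↔ uncentred second moments, then raw quotient form
  have v00 : (∫ z, ((Real.log (ρ Ts (Φ (V00, z))) - Real.log (ρ' Ts (Φ (V00, z)))) - c₀₀) ^ 2 * (wgt F γ b₀ p₀ j Ts ρ ρ' τ Φ J t) V00 z ∂τ) = (∫ z, (Real.log (ρ Ts (Φ (V00, z))) - Real.log (ρ' Ts (Φ (V00, z)))) * (Real.log (ρ Ts (Φ (V00, z))) - Real.log (ρ' Ts (Φ (V00, z)))) * (wgt F γ b₀ p₀ j Ts ρ ρ' τ Φ J t) V00 z ∂τ) - (∫ z, (Real.log (ρ Ts (Φ (V00, z))) - Real.log (ρ' Ts (Φ (V00, z)))) * (wgt F γ b₀ p₀ j Ts ρ ρ' τ Φ J t) V00 z ∂τ) * (∫ z, (Real.log (ρ Ts (Φ (V00, z)))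 - Real.log (ρ' Ts (Φ (V00, z)))) * (wgt F γ b₀ p₀ j Ts ρ ρ' τ Φ J t) V00 z ∂τ) := by
    rw [hc₀₀]; exact integral_centred_sq_eq (A := fun z => (Real.log (ρ Ts (Φ (V00, z))) - Real.log (ρ' Ts (Φ (V00, z))))) n00 iF00 iFF00 iW00
  have v10 : (∫ z, ((Real.log (ρ Ts (Φ (V00, z))) - Real.log (ρ' Ts (Φ (V00, z)))) - c₁₀) ^ 2 * (wgt F γ b₀ p₀ j Ts ρ ρ' τ Φ J t) V10 z ∂τ) = (∫ z, (Real.log (ρ Ts (Φ (V00, z))) - Real.log (ρ' Ts (Φ (V00, z)))) * (Real.log (ρ Ts (Φ (V00, z))) - Real.log (ρ' Ts (Φ (V00, z)))) * (wgt F γ b₀ p₀ j Ts ρ ρ' τ Φ J t) V10 z ∂τ) - (∫ z, (Real.log (ρ Ts (Φ (V00, z))) - Real.log (ρ' Ts (Φ (V00, z)))) * (wgt F γ b₀ p₀ j Ts ρ ρ' τ Φ J t) V10 z ∂τ) * (∫ z, (Real.log (ρ Ts (Φ (V00, z))) - Real.log (ρ' Ts (Φ (V00, z)))) * (wgt F γ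 b₀ p₀ j Ts ρ ρ' τ Φ J t) V10 z ∂τ) := by
    rw [hc₁₀]; exact integral_centred_sq_eq (A := fun z => (Real.log (ρ Ts (Φ (V00, z))) - Real.log (ρ' Ts (Φ (V00, z))))) n10 iF10 iFF10 iW10
  have v01 : (∫ z, ((Real.log (ρ Ts (Φ (V00, z))) - Real.log (ρ' Ts (Φ (V00, z)))) - c₀₁) ^ 2 * (wgt F γ b₀ p₀ j Ts ρ ρ' τ Φ J t) V01 z ∂τ) = (∫ z, (Real.log (ρ Ts (Φ (V00, z))) - Real.log (ρ' Ts (Φ (V00, z)))) * (Real.log (ρ Ts (Φ (V00, z))) - Real.log (ρ' Ts (Φ (V00, z)))) * (wgt F γ b₀ p₀ j Ts ρ ρ' τ Φ J t) V01 z ∂τ) - (∫ z, (Real.log (ρ Ts (Φ (V00, z))) - Real.log (ρ' Ts (Φ (V00, z)))) * (wgt F γ b₀ p₀ j Ts ρ ρ' τ Φ J t) V01 z ∂τ) * (∫ z, (Real.log (ρ Ts (Φ (V00, z))) - Real.log (ρ' Ts (Φ (V00, z)))) * (wgt F γ b₀ p₀ j Ts ρ ρ' τ Φ J t) V01 z ∂τ)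 := by
    rw [hc₀₁]; exact integral_centred_sq_eq (A := fun z => (Real.log (ρ Ts (Φ (V00, z))) - Real.log (ρ' Ts (Φ (V00, z))))) n01 iF01 iFF01 iW01
  have v11 : (∫ z, ((Real.log (ρ Ts (Φ (V00, z))) - Real.log (ρ' Ts (Φ (V00, z)))) - c₁₁) ^ 2 * (wgt F γ b₀ p₀ j Ts ρ ρ' τ Φ J t) V11 z ∂τ) = (∫ z, (Real.log (ρ Ts (Φ (V00, z))) - Real.log (ρ' Ts (Φ (V00, z)))) * (Real.log (ρ Ts (Φ (V00, z))) - Real.log (ρ' Ts (Φ (V00, z)))) * (wgt F γ b₀ p₀ j Ts ρ ρ' τ Φ J t) V11 z ∂τ) - (∫ z, (Real.log (ρ Ts (Φ (V00, z))) - Real.log (ρ' Ts (Φ (V00, z)))) * (wgt F γ b₀ p₀ j Ts ρ ρ' τ Φ J t) V11 z ∂τ) * (∫ z, (Real.log (ρ Ts (Φ (V00, z))) - Real.log (ρ' Ts (Φ (V00, z)))) * (wgt F γ b₀ p₀ j Ts ρ ρ' τ Φ J t) V11 z ∂τ) := by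
    rw [hc₁₁]; exact integral_centred_sq_eq (A := fun z => (Real.log (ρ Ts (Φ (V00, z))) - Real.log (ρ' Ts (Φ (V00, z))))) n11 iF11 iFF11 iW11
  rw [v00, v10, v01, v11]
  rw [integral_mul_wgt_eq_div F γ b₀ p₀ j Ts ρ ρ' τ Φ J t V00 (fun z => (Real.log (ρ Ts (Φ (V00, z))) - Real.log (ρ' Ts (Φ (V00, z)))) * (Real.log (ρ Ts (Φ (V00, z))) - Real.log (ρ' Ts (Φ (V00, z))))), integral_mul_wgt_eq_div F γ b₀ p₀ j Ts ρ ρ' τ Φ J t V00 (fun z => (Real.log (ρ Ts (Φ (V00, z))) - Real.log (ρ' Ts (Φ (V00, z))))),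
    integral_mul_wgt_eq_div F γ b₀ p₀ j Ts ρ ρ' τ Φ J t V10 (fun z => (Real.log (ρ Ts (Φ (V00, z))) - Real.log (ρ' Ts (Φ (V00, z)))) * (Real.log (ρ Ts (Φ (V00, z))) - Real.log (ρ' Ts (Φ (V00, z))))), integral_mul_wgt_eq_div F γ b₀ p₀ j Ts ρ ρ' τ Φ J t V10 (fun z => (Real.log (ρ Ts (Φ (V00, z))) - Real.log (ρ' Ts (Φ (V00, z))))),
    integral_mul_wgt_eq_div F γ b₀ p₀ j Ts ρ ρ' τ Φ J t V01 (fun z => (Real.log (ρ Ts (Φ (V00, z))) - Real.log (ρ' Ts (Φ (V00, z)))) * (Real.log (ρ Ts (Φ (V00, z))) - Real.log (ρ' Ts (Φ (V00, z))))), integral_mul_wgt_eq_div F γ b₀ p₀ j Ts ρ ρ' τ Φ J t V01 (fun z => (Real.log (ρ Ts (Φ (V00, z))) - Real.log (ρ' Ts (Φ (V00, z))))),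
    integral_mul_wgt_eq_div F γ b₀ p₀ j Ts ρ ρ' τ Φ J t V11 (fun z => (Real.log (ρ Ts (Φ (V00, z))) - Real.log (ρ' Ts (Φ (V00, z)))) * (Real.log (ρ Ts (Φ (V00, z))) - Real.log (ρ' Ts (Φ (V00, z))))), integral_mul_wgt_eq_div F γ b₀ p₀ j Ts ρ ρ' τ Φ J t V11 (fun z => (Real.log (ρ Ts (Φ (V00, z))) - Real.log (ρ' Ts (Φ (V00, z)))))]
  -- the variance square along the path ((L26a)), read at the corners
  have hsq := abs_normVar_secondDiff_le (w := fun s s' z => wNum F γ b₀ p₀ j Ts ρ ρ' Φ J t (X s s') z) (w₁ := w₁) (w₂ := w₂) (w₁₂ := w₁₂) (Fo := fun z => (Real.log (ρ Ts (Φ (V00, z))) - Real.log (ρ' Ts (Φ (V00, z))))) hU hUI hmF hm hm₁ hm₂ hm₁₂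
    hi hiF hiFF hi₂ hiF₂ hiFF₂ hb₁ hb₁i hb₁F hb₁Fi hb₁FF hb₁FFi hb₂ hb₂i hb₂F hb₂Fi hb₂FF hb₂FFi hb₁₂ hb₁₂i hb₁₂F hb₁₂Fi hb₁₂FF hb₁₂FFi hd₂ hd₁ hd₁₂ hZ
    φ φ₁ φ₂ φ₁₂ ψ ψ₂ ψ₁₂ hφ hφ₁ hφ₂ hφ₁₂ hψ hψ₂ hψ₁₂ hker
  rw [hψ, hψ, hψ, hψ, hφ, hφ, hφ, hφ, hX00, hX10, hX01, hX11] at hsq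
  exact hsq

end VarSquare

end Summit.QuantumFields.YangMills.Theorems.OrganTangentLawCumulantIntegration

end
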